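import Literature.NumberTheory.Rogawski1990.ArchStableSumGClassSum               -- ★ (2) (LH10-p02 (g9)) p851904∕p851944: `stableSumG`, `partnerPerms`, `stableSumG_eq_archRG_mul_sum`
import Literature.NumberTheory.Rogawski1990.ArchHCOrbitalFamilyGExt               -- ★ CUT B: `orbFamGExt`, `orbFamGExt_of_mem_regG_of_admissible`; brings `orbFamG ∕ chartOrbG ∕ chartTorusG ∕ chartQuotientMeasureG`
import Literature.NumberTheory.Rogawski1990.ArchTestFunctionsNonnegAtPoint        -- ★ (N1′) (LH5-p03): `exists_archSmooth_nonneg_eq_one_at` (non-negative bumps on `G′_∞`), `archSmooth_zero`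
import Literature.NumberTheory.Rogawski1990.ArchBouazizStableFamilyLinear         -- ★ (S-lin) (LH3-p02): `integrable_descConj_of_uniformlyProper` (generic)
import Literature.NumberTheory.Automorphic.ArchEndoscopicChartOrbLocalPos           -- ★ (N2): `integral_descConj_pos_of_nonneg` (generic); brings ★ `isOpenPosMeasure_quotientMeasure`
import Literature.NumberTheory.Automorphic.ArchInnerFormChartOrbitalSmooth          -- ★ `uniformlyProper_gprimeTorus_chartTorusG_regG`
import Literature.NumberTheory.Automorphic.ArchInnerFormChartOrbWeyl                -- ★ `toReal_chartHaarG_chartBoxImgG_pos`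
import Literature.NumberTheory.Automorphic.ArchInnerFormChartExhaustion             -- ★ `gprimeCptGL_congr`, `gprimeSplitGL_congr` (`2π`-periodicity of the chart)
import HarnessLib

/-!
# Non-negative test functions on `G′_∞ = U(diag α)(L⁺ ⊗ ℝ)` positive on a prescribed compact set, and NON-VANISHING of the STABLE SUM of their wall-extended orbital families at
# the regular chart points with bounded split coordinates (N8-INNER brick (7) F5 = (Σ4b-G); Bouaziz 1994 §2.3, §5.1; Shelstad 1979 §4; Rogawski 1990 §4.1, §8.2)

Topic `NumberTheory/Rogawski1990`; namespace `Literature.NumberTheory.Rogawski1990`.  THEOREMS ONLY (no `def`, no instance, no notation, no axiom, no named fact, no `sorry`).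
Cell `pub/hodgecm-mathlib`, crux H413 (`stmt-HodgeConjecture-24833`), F0∕P3c road «N8-INNER» (LEAD T14-4; row 2 `stub_N8`, archimedean INNER transfer), brick (7) «(Σ-REG-G)» (owner
LH3-p04 (g7), CENSUS (Σ-REG-G) v1.1 718e993941fbbb38 §5 (c)), sub-brick **F5 «(Σ4b-G) POSITIVE TEST FUNCTION»** (LH2-plan (g1) deal 2026-09-02T15:59:55Z → LH7-p01 (g7)).  The
`G′`-side twin of ★ (Σ4b) `ArchBouazizPositiveTestFunction` (F0P3a-p04 (g25), p851507) in the STABLE-SUM currency ★ `stableSumG` of brick (2).  Count-neutral.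

THE POINT.  The (Σ-REG-G) multiplier road realises a member `Ψ` of the stable space near a regular base class as `stableSumG (orbFamGExt ((F ∘ cl_G) · a₀))` with
`F = (Ψ ∕ stableSumG (orbFamGExt a₀)) ∘ σ`; it needs ONE `a₀ ∈ C_c^∞(G′_∞)` whose STABLE orbital family does NOT VANISH at the regular chart points near the base class.  Here: for every
house frame `α` (`α_i ≠ 0`), every ADMISSIBLE chart type `S′` (`S′ ⊆ splitChartPlaces L α`) and every bound `R` there is a real non-negative `a ∈ C_c^∞(G′_∞)` with
`stableSumG (orbFamGExt L α ν′ a) S′ c ≠ 0` at EVERY `c ∈ RegG S′` with `|x_w| ≤ R` at the chart places (§5).  By the class-sum reading ★ `stableSumG_eq_archRG_mul_sum` of brick (2)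
(the family is `R′`-normalised on the partner points, ★ `orbFamGExt_of_mem_regG_of_admissible` at the regular points `slotPerm ρ c`, ★ `slotPerm_mem_regG_iff`), the stable sum is
`R′(c) · Σ_{ρ ∈ partnerPerms S′} chartOrbG ν′ S′ a (slotPerm ρ c)` — a POSITIVE multiple (`R′ ≠ 0` on `RegG`, ★ `archRG_ne_zero_of_mem_regG`) of a sum of NON-NEGATIVE reals whose
`ρ = 1` term is the chart orbital integral of `a ≥ 0` at `gprimeTorus α S′ c`, a POSITIVE real as soon as `a(gprimeTorus α S′ c) > 0` (§3: the invariant quotient measure charges open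
sets, ★ `isOpenPosMeasure_quotientMeasure`; the integrand is integrable at regular points, ★ `uniformlyProper_gprimeTorus_chartTorusG_regG`; the box mass is positive, ★
`toReal_chartHaarG_chartBoxImgG_pos`); the chart points with angles reduced mod `2π` and `|x_w| ≤ R` form a compact set (§4), on which a finite sum of ★ (N1′) bumps is positive (§1–§2).
No unit twist enters: the twists `u_ρ(c)` of `stableSumG` are eaten by the relabelled normalisers (★ `stableTwistG_mul_archRG_slotPerm`, inside the bridge).
* §0 `ArchSmooth.add`, `ArchSmooth.finset_sum` — `C_c^∞(G′_∞)` (★ `ArchSmooth`, by restriction) is closed under finite sums (★ `archSmooth` is a submodule; ★ `archSmooth_zero`).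
* §1 `exists_real_archSmooth_pos_at (k₀)` — a real `a ≥ 0` in `C_c^∞(G′_∞)` with `a k₀ > 0` (★ `exists_archSmooth_nonneg_eq_one_at`, real part).
* §2 `exists_real_archSmooth_pos_on (hE : IsCompact E)` — the same, positive on all of `E` (finite subcover, §0).
* §3 `chartOrbG_ofReal`, `chartOrbG_ofReal_re_nonneg`, **`chartOrbG_ofReal_re_pos`** (`c ∈ RegG S′`, `a(gprimeTorus α S′ c) > 0`), `sum_partnerPerms_chartOrbG_ofReal_re_pos`,
  **`stableSumG_orbFamGExt_ofReal_ne_zero`**.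
* §4 `gprimeTorus_eq_of_circleExp_eq` (the chart sees the angle slots only through `e^{iθ}`), `exists_reduced_gprimeTorus_eq`, `isCompact_gprimeTorus_image_box`, `gprimeTorus_mem_image_box`.
* §5 HEAD **`exists_archSmooth_stableSumG_orbFamGExt_ne_zero (L α ν′) (hα) (S′) (hS′) (R) : ∃ a, ArchSmooth L 3 (diagonal α) a ∧ ∀ c ∈ RegG S′, (∀ w ∈ S′, |c w 0| ≤ R) →
  stableSumG (orbFamGExt L α ν′ a) S′ c ≠ 0`** (+ the real, non-negative reading `exists_real_archSmooth_stableSumG_orbFamGExt_ne_zero`).  On the `G`-side of the road (`α := β₀`,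
  every place a split-chart place) `hS′` is ★ `mem_splitChartPlaces_quasiSplitWeights`.
HONEST LABEL: HC_CM is proved only modulo the 7 printed citations (2 remaining: hLiu418 = `stmt-HodgeConjecture-24832`, h413 = `stmt-HodgeConjecture-24833`) until rung 0 closes; this file is
measure plumbing for (Σ-REG-G) and pays nothing by itself (count-neutral until the junction payer is ★ and ED. 43 re-keys 27456 6 → 5).

## References
* [Bouaziz1994IntegralesOrbitales] A. Bouaziz, *Intégrales orbitales sur les groupes de Lie réductifs*, Ann. Sci. ÉNS (4) 27 (1994) 573–609, §2.3 p. 578, §5.1 p. 588.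
* [Varadarajan1989] V. S. Varadarajan, *An Introduction to Harmonic Analysis on Semisimple Lie Groups*, Cambridge Stud. Adv. Math. 16 (1989), §6 p. 229.
* [Rogawski1990] J. D. Rogawski, *Automorphic Representations of Unitary Groups in Three Variables*, Ann. of Math. Stud. 123 (1990), §8.2 p. 122, §4.1 (4.1.1) p. 39, §3.6 p. 28.
* [Shelstad1979] D. Shelstad, *Characters and inner forms of a quasi-split group over ℝ*, Compositio Math. 39 (1979), §4 pp. 22–23, Lemma 4.2.
* [DeitmarEchterhoff2014] A. Deitmar, S. Echterhoff, *Principles of Harmonic Analysis*, 2nd ed., Thm. 1.5.3.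
* [BorelJacquet1979] A. Borel, H. Jacquet, *Automorphic forms and automorphic representations*, Proc. Sympos. Pure Math. 33 (1979), part 1, §4.1.
-/

set_option autoImplicit false

noncomputable section

open MeasureTheory MeasureTheory.Measure NumberField NumberField.InfinitePlace Complex Set Function Filter Topology
open Literature.NumberTheory.Automorphic Literature.NumberTheory.Automorphic.UnitaryGroup Literature.NumberTheory.Automorphic.ArchCartan
open Literature.MeasureTheory.Group
open scoped Classical

namespace Literature.NumberTheory.Rogawski1990

/-! ## §0 `C_c^∞(G′_∞)` is closed under finite sums -/

section Algebra

variable (L : Type) [Field L] [NumberField L] [IsCMField L] {N : ℕ} {H : Matrix (Fin N) (Fin N) L}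

/-- **`C_c^∞(U(H)(L⁺ ⊗ ℝ))` (★ `ArchSmooth`, by restriction) IS CLOSED UNDER ADDITION** (★ `archSmooth` is a submodule; continuity and compact support add).
[cite: BorelJacquet1979, §4.1] [cite: Rogawski1990, §14.2 p. 233] -/
theorem ArchSmooth.add {a b : ↥(arch (↥(maximalRealSubfield L)) L (IsCMField.complexConj L) N H) → ℂ} (ha : ArchSmooth L N H a) (hb : ArchSmooth L N H b) :
    ArchSmooth L N H (a + b) := by
  obtain ⟨φ, hφc, hφs, hφsm, hφa⟩ := ha
  obtain ⟨ψ, hψc, hψs, hψsm, hψa⟩ := hb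
  refine ⟨φ + ψ, hφc.add hψc, hφs.add hψs, ?_, fun k => ?_⟩
  · exact (mem_archSmooth_iff _ _).1 (Submodule.add_mem _ ((mem_archSmooth_iff _ _).2 hφsm) ((mem_archSmooth_iff _ _).2 hψsm))
  · simp only [Pi.add_apply, hφa k, hψa k]

/-- **`C_c^∞(U(H)(L⁺ ⊗ ℝ))` IS CLOSED UNDER FINITE SUMS** (★ `archSmooth_zero`, `ArchSmooth.add`). [cite: BorelJacquet1979, §4.1] [cite: Rogawski1990, §14.2 p. 233] -/
theorem ArchSmooth.finset_sum {ι : Type*} (s : Finset ι) {a : ι → ↥(arch (↥(maximalRealSubfield L)) L (IsCMField.complexConj L) N H) → ℂ}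
    (h : ∀ i ∈ s, ArchSmooth L N H (a i)) : ArchSmooth L N H (∑ i ∈ s, a i) := by
  classical
  induction s using Finset.induction_on with
  | empty =>
    rw [Finset.sum_empty]
    exact archSmooth_zero L N H
  | insert i s hi ih =>
    rw [Finset.sum_insert hi]
    exact (h i (Finset.mem_insert_self i s)).add L (ih fun j hj => h j (Finset.mem_insert_of_mem hj))

end Algebra

/-! ## §1 A real non-negative test function positive at a prescribed point -/

section Point

variable (L : Type) [Field L] [NumberField L] [IsCMField L] (α : Fin 3 → L)

/-- **A REAL NON-NEGATIVE `C_c^∞(G′_∞)` FUNCTION POSITIVE AT `k₀`** — the real part of the ★ (N1′) bump `exists_archSmooth_nonneg_eq_one_at` (value `1` at `k₀`, real non-negative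
values). [cite: BorelJacquet1979, §4.1] [cite: Bouaziz1994IntegralesOrbitales, §2.3 p. 578] -/
theorem exists_real_archSmooth_pos_at (k₀ : ↥(arch (↥(maximalRealSubfield L)) L (IsCMField.complexConj L) 3 (Matrix.diagonal α))) :
    ∃ f : ↥(arch (↥(maximalRealSubfield L)) L (IsCMField.complexConj L) 3 (Matrix.diagonal α)) → ℝ,
      Continuous f ∧ (∀ k, 0 ≤ f k) ∧ 0 < f k₀ ∧ ArchSmooth L 3 (Matrix.diagonal α) (fun k => ((f k : ℝ) : ℂ)) := by
  obtain ⟨a, ha, -, hre, h1⟩ := exists_archSmooth_nonneg_eq_one_at L 3 (Matrix.diagonal α) k₀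
  have hreal : (fun k => (((a k).re : ℝ) : ℂ)) = a := by
    funext k
    exact Complex.ext (by rw [Complex.ofReal_re]) (by rw [Complex.ofReal_im, (hre k).2])
  refine ⟨fun k => (a k).re, Complex.continuous_re.comp ha.continuous, fun k => (hre k).1, ?_, by rw [hreal]; exact ha⟩
  show 0 < (a k₀).re
  rw [h1, Complex.one_re]
  exact one_pos

end Point

/-! ## §2 A real non-negative test function positive on a prescribed compact set -/

section Compact

variable (L : Type) [Field L] [NumberField L] [IsCMField L] (α : Fin 3 → L)

/-- **A REAL NON-NEGATIVE `C_c^∞(G′_∞)` FUNCTION POSITIVE ON A COMPACT SET** — a finite sum of the bumps of §1 over a finite subcover of `E` by their positivity sets (§0 `ArchSmooth.finset_sum`).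
[cite: Bouaziz1994IntegralesOrbitales, §2.3 p. 578] [cite: BorelJacquet1979, §4.1] -/
theorem exists_real_archSmooth_pos_on {E : Set ↥(arch (↥(maximalRealSubfield L)) L (IsCMField.complexConj L) 3 (Matrix.diagonal α))} (hE : IsCompact E) :
    ∃ f : ↥(arch (↥(maximalRealSubfield L)) L (IsCMField.complexConj L) 3 (Matrix.diagonal α)) → ℝ,
      Continuous f ∧ (∀ k, 0 ≤ f k) ∧ (∀ k ∈ E, 0 < f k) ∧ ArchSmooth L 3 (Matrix.diagonal α) (fun k => ((f k : ℝ) : ℂ)) := by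
  choose f hfc hf0 hfpos hfa using exists_real_archSmooth_pos_at L α
  -- the positivity sets cover `E`
  have hcover : E ⊆ ⋃ k₀ ∈ E, {k | 0 < f k₀ k} := fun k hk => mem_iUnion₂.2 ⟨k, hk, hfpos k⟩
  obtain ⟨t, -, ht, hcov⟩ := hE.elim_finite_subcover_image (fun k₀ _ => isOpen_lt continuous_const (hfc k₀)) hcover
  refine ⟨fun k => ∑ k₀ ∈ ht.toFinset, f k₀ k, continuous_finsetSum _ fun k₀ _ => hfc k₀, fun k => Finset.sum_nonneg fun k₀ _ => hf0 k₀ k, fun k hk => ?_, ?_⟩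
  · obtain ⟨k₀, hk₀, hk⟩ := mem_iUnion₂.1 (hcov hk)
    exact Finset.sum_pos' (fun k₁ _ => hf0 k₁ k) ⟨k₀, ht.mem_toFinset.2 hk₀, hk⟩
  · have h := ArchSmooth.finset_sum L ht.toFinset (a := fun k₀ k => ((f k₀ k : ℝ) : ℂ)) fun k₀ _ => hfa k₀
    refine (congrArg (ArchSmooth L 3 (Matrix.diagonal α)) ?_).mp h
    funext k
    rw [Finset.sum_apply, Complex.ofReal_sum]

end Compact

/-! ## §3 The chart orbital functional of a real non-negative function is a non-negative real, positive when the function is positive at the chart point -/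

section Orb

variable (L : Type) [Field L] [NumberField L] [IsCMField L] (α : Fin 3 → L)
  [MeasurableSpace ↥(arch (↥(maximalRealSubfield L)) L (IsCMField.complexConj L) 3 (Matrix.diagonal α))] [BorelSpace ↥(arch (↥(maximalRealSubfield L)) L (IsCMField.complexConj L) 3 (Matrix.diagonal α))]
  (ν' : Measure ↥(arch (↥(maximalRealSubfield L)) L (IsCMField.complexConj L) 3 (Matrix.diagonal α)))

/-- **The chart orbital functional of a real function is real**: `chartOrbG L α ν′ S′ (a : ℂ) c = ↑(dt′(B′) · ∫ a(y γ′ y⁻¹))`. [cite: Rogawski1990, §8.2 p. 122] -/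
theorem chartOrbG_ofReal [IsFiniteMeasureOnCompacts ν'] [ν'.IsMulRightInvariant] (S' : Finset {w : InfinitePlace L // IsComplex w})
    (f : ↥(arch (↥(maximalRealSubfield L)) L (IsCMField.complexConj L) 3 (Matrix.diagonal α)) → ℝ) (c : {w : InfinitePlace L // IsComplex w} → Fin 3 → ℝ) :
    chartOrbG L α ν' S' (fun k => ((f k : ℝ) : ℂ)) c =
      (letI : MeasurableSpace (↥(arch (↥(maximalRealSubfield L)) L (IsCMField.complexConj L) 3 (Matrix.diagonal α)) ⧸ chartTorusG L α S') := borel _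
       (((chartHaarG L α S' (chartBoxImgG L α S')).toReal *
          ∫ y, descConj (gprimeTorus L α S' c) (chartTorusG L α S') (forall_mem_chartTorusG_comm L α S' c) f y ∂(chartQuotientMeasureG L α ν' S') : ℝ) : ℂ)) := by
  letI : MeasurableSpace (↥(arch (↥(maximalRealSubfield L)) L (IsCMField.complexConj L) 3 (Matrix.diagonal α)) ⧸ chartTorusG L α S') := borel _
  haveI : BorelSpace (↥(arch (↥(maximalRealSubfield L)) L (IsCMField.complexConj L) 3 (Matrix.diagonal α)) ⧸ chartTorusG L α S') := ⟨rfl⟩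
  rw [chartOrbG_def]
  have hcomp : descConj (gprimeTorus L α S' c) (chartTorusG L α S') (forall_mem_chartTorusG_comm L α S' c)
        (fun k : ↥(arch (↥(maximalRealSubfield L)) L (IsCMField.complexConj L) 3 (Matrix.diagonal α)) => ((f k : ℝ) : ℂ)) =
      fun y => ((descConj (gprimeTorus L α S' c) (chartTorusG L α S') (forall_mem_chartTorusG_comm L α S' c) f y : ℝ) : ℂ) := by
    funext y
    induction y using QuotientGroup.induction_on with
    | H g => rfl
  rw [hcomp, integral_complex_ofReal, Complex.ofReal_mul]

/-- **For `a ≥ 0` the chart orbital functional is a non-negative real** (`∫` of a non-negative function; Bochner integral `0` if not integrable). [cite: Rogawski1990, §8.2 p. 122] -/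
theorem chartOrbG_ofReal_re_nonneg [IsFiniteMeasureOnCompacts ν'] [ν'.IsMulRightInvariant] (S' : Finset {w : InfinitePlace L // IsComplex w})
    {f : ↥(arch (↥(maximalRealSubfield L)) L (IsCMField.complexConj L) 3 (Matrix.diagonal α)) → ℝ} (h0 : ∀ k, 0 ≤ f k) (c : {w : InfinitePlace L // IsComplex w} → Fin 3 → ℝ) :
    0 ≤ (chartOrbG L α ν' S' (fun k => ((f k : ℝ) : ℂ)) c).re ∧ (chartOrbG L α ν' S' (fun k => ((f k : ℝ) : ℂ)) c).im = 0 := by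
  letI : MeasurableSpace (↥(arch (↥(maximalRealSubfield L)) L (IsCMField.complexConj L) 3 (Matrix.diagonal α)) ⧸ chartTorusG L α S') := borel _
  haveI : BorelSpace (↥(arch (↥(maximalRealSubfield L)) L (IsCMField.complexConj L) 3 (Matrix.diagonal α)) ⧸ chartTorusG L α S') := ⟨rfl⟩
  rw [chartOrbG_ofReal, Complex.ofReal_re, Complex.ofReal_im]
  refine ⟨mul_nonneg ENNReal.toReal_nonneg (integral_nonneg fun y => ?_), rfl⟩
  induction y using QuotientGroup.induction_on with
  | H g => exact h0 _

/-- **POSITIVITY**: for a Haar measure `ν′`, `a ≥ 0` continuous with compact support, an admissible chart `S′`, a REGULAR chart point `c` (closed orbit: the quotient integrand is integrable,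
★ `uniformlyProper_gprimeTorus_chartTorusG_regG`) and `a(gprimeTorus α S′ c) > 0`, the chart orbital functional is a POSITIVE real (the invariant quotient measure charges open sets, ★
`isOpenPosMeasure_quotientMeasure`; the box mass is positive, ★ `toReal_chartHaarG_chartBoxImgG_pos`). [cite: Rogawski1990, §8.2 p. 122] [cite: DeitmarEchterhoff2014, Thm. 1.5.3] -/
theorem chartOrbG_ofReal_re_pos [ν'.IsHaarMeasure] [ν'.IsMulRightInvariant] (hα : ∀ i, α i ≠ 0) {S' : Finset {w : InfinitePlace L // IsComplex w}}
    (hS' : ∀ w, w ∈ S' → w ∈ splitChartPlaces L α)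
    {f : ↥(arch (↥(maximalRealSubfield L)) L (IsCMField.complexConj L) 3 (Matrix.diagonal α)) → ℝ}
    (hf : Continuous f) (hfc : HasCompactSupport f) (h0 : ∀ k, 0 ≤ f k) {c : {w : InfinitePlace L // IsComplex w} → Fin 3 → ℝ} (hc : c ∈ RegG S')
    (hpos : 0 < f (gprimeTorus L α S' c)) :
    0 < (chartOrbG L α ν' S' (fun k => ((f k : ℝ) : ℂ)) c).re := by
  letI : MeasurableSpace (↥(arch (↥(maximalRealSubfield L)) L (IsCMField.complexConj L) 3 (Matrix.diagonal α)) ⧸ chartTorusG L α S') := borel _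
  haveI : BorelSpace (↥(arch (↥(maximalRealSubfield L)) L (IsCMField.complexConj L) 3 (Matrix.diagonal α)) ⧸ chartTorusG L α S') := ⟨rfl⟩
  rw [chartOrbG_ofReal, Complex.ofReal_re]
  haveI := locallyCompactSpace_chartTorusG L α S'
  haveI := isHaarMeasure_chartHaarG L α S'
  haveI := isInvInvariant_chartHaarG L α S'
  have hopen : (chartQuotientMeasureG L α ν' S').IsOpenPosMeasure := by
    unfold chartQuotientMeasureG
    exact isOpenPosMeasure_quotientMeasure (chartTorusG L α S') (isClosed_chartTorusG L α S') (chartHaarG L α S') ν'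
  haveI := hopen
  haveI : IsFiniteMeasureOnCompacts (chartQuotientMeasureG L α ν' S') := by
    unfold chartQuotientMeasureG
    infer_instance
  have hint : Integrable (descConj (gprimeTorus L α S' c) (chartTorusG L α S') (forall_mem_chartTorusG_comm L α S' c) f) (chartQuotientMeasureG L α ν' S') :=
    integrable_descConj_of_uniformlyProper (chartTorusG L α S') (forall_mem_chartTorusG_comm L α S') (uniformlyProper_gprimeTorus_chartTorusG_regG L α S' hα hS')
      (chartQuotientMeasureG L α ν' S') hf hfc hc
  refine mul_pos (toReal_chartHaarG_chartBoxImgG_pos L α S' hα hS') ?_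
  exact integral_descConj_pos_of_nonneg (gprimeTorus L α S' c) (chartTorusG L α S') (forall_mem_chartTorusG_comm L α S' c) (chartQuotientMeasureG L α ν' S') hf h0 hint
    (x₀ := 1) (by simpa using hpos.ne')

/-- **THE SLOT-LABEL SUM of the chart functionals of `a ≥ 0` HAS POSITIVE REAL PART** as soon as `a(gprimeTorus α S′ c) > 0` at the regular chart point `c` (the `ρ = 1` term is positive,
the relabelled terms are `≥ 0`). [cite: Rogawski1990, §4.1 (4.1.1) p. 39] [cite: Shelstad1979, Lemma 4.2 p. 23] -/
theorem sum_partnerPerms_chartOrbG_ofReal_re_pos [ν'.IsHaarMeasure] [ν'.IsMulRightInvariant] (hα : ∀ i, α i ≠ 0) {S' : Finset {w : InfinitePlace L // IsComplex w}}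
    (hS' : ∀ w, w ∈ S' → w ∈ splitChartPlaces L α)
    {f : ↥(arch (↥(maximalRealSubfield L)) L (IsCMField.complexConj L) 3 (Matrix.diagonal α)) → ℝ}
    (hf : Continuous f) (hfc : HasCompactSupport f) (h0 : ∀ k, 0 ≤ f k) {c : {w : InfinitePlace L // IsComplex w} → Fin 3 → ℝ} (hc : c ∈ RegG S')
    (hpos : 0 < f (gprimeTorus L α S' c)) :
    0 < (∑ ρ ∈ partnerPerms S', chartOrbG L α ν' S' (fun k => ((f k : ℝ) : ℂ)) (slotPerm ρ c)).re := by
  rw [Complex.re_sum]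
  have hmem : (1 : {w : InfinitePlace L // IsComplex w} → Equiv.Perm (Fin 3)) ∈ partnerPerms S' := (mem_partnerPerms_iff S' 1).2 fun _ _ => rfl
  rw [← Finset.add_sum_erase _ _ hmem]
  refine add_pos_of_pos_of_nonneg ?_ (Finset.sum_nonneg fun ρ _ => (chartOrbG_ofReal_re_nonneg L α ν' S' h0 _).1)
  rw [slotPerm_one]
  exact chartOrbG_ofReal_re_pos L α ν' hα hS' hf hfc h0 hc hpos

/-- **NON-VANISHING OF THE STABLE SUM OF THE WALL-EXTENDED ORBITAL FAMILY OF `a ≥ 0` AT A REGULAR CHART POINT WHERE `a(gprimeTorus α S′ c) > 0`**: by the class-sum reading ★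
`stableSumG_eq_archRG_mul_sum` (the family is `R′ · chartOrbG` on the partner points, ★ `orbFamGExt_of_mem_regG_of_admissible`, ★ `slotPerm_mem_regG_iff`) the stable sum is
`R′_{S′}(c) · Σ_ρ chartOrbG … (slotPerm ρ c)`, and `R′ ≠ 0` on `RegG S′` (★ `archRG_ne_zero_of_mem_regG`). [cite: Shelstad1979, §4 p. 22, Lemma 4.2 p. 23] [cite: Rogawski1990, §4.1 (4.1.1) p. 39] -/
theorem stableSumG_orbFamGExt_ofReal_ne_zero [ν'.IsHaarMeasure] [ν'.IsMulRightInvariant] (hα : ∀ i, α i ≠ 0) {S' : Finset {w : InfinitePlace L // IsComplex w}}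
    (hS' : ∀ w, w ∈ S' → w ∈ splitChartPlaces L α)
    {f : ↥(arch (↥(maximalRealSubfield L)) L (IsCMField.complexConj L) 3 (Matrix.diagonal α)) → ℝ}
    (hf : Continuous f) (hfc : HasCompactSupport f) (h0 : ∀ k, 0 ≤ f k) {c : {w : InfinitePlace L // IsComplex w} → Fin 3 → ℝ} (hc : c ∈ RegG S')
    (hpos : 0 < f (gprimeTorus L α S' c)) :
    stableSumG (orbFamGExt L α ν' (fun k => ((f k : ℝ) : ℂ))) S' c ≠ 0 := by
  rw [stableSumG_eq_archRG_mul_sum (Φ := chartOrbG L α ν' S' (fun k => ((f k : ℝ) : ℂ)))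
    (fun ρ hρ => orbFamGExt_of_mem_regG_of_admissible L α ν' _ S' hS' ((slotPerm_mem_regG_iff hρ c).2 hc))]
  refine mul_ne_zero (archRG_ne_zero_of_mem_regG hc) fun h => ?_
  have hre := sum_partnerPerms_chartOrbG_ofReal_re_pos L α ν' hα hS' hf hfc h0 hc hpos
  rw [h, Complex.zero_re] at hre
  exact lt_irrefl _ hre

end Orb

/-! ## §4 Reduction of the angle slots mod `2π`; the compact torus piece -/

section Box

variable (L : Type) [Field L] [NumberField L] [IsCMField L] (α : Fin 3 → L)

/-- `Circle.exp x = Circle.exp y ⇒ e^{ix} = e^{iy}` in `ℂ` (★ `Circle.coe_exp`). [folklore] [cite: Rogawski1990, §3.6 p. 28] -/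
private theorem cexp_mul_I_eq_of_circleExp_eq {x y : ℝ} (h : Circle.exp x = Circle.exp y) : Complex.exp ((x : ℂ) * I) = Complex.exp ((y : ℂ) * I) := by
  rw [← Circle.coe_exp, ← Circle.coe_exp, h]

/-- **THE CHART SEES THE ANGLE SLOTS ONLY THROUGH `e^{iθ}`**: two coordinates with the same chart slots `c w 0` (`w ∈ S′`) and the same `Circle.exp` of every other slot give the same chart
point (★ `gprimeCptGL_congr`, ★ `gprimeSplitGL_congr`, place by place). [cite: Rogawski1990, §3.6 p. 28; §8.2 p. 122] -/
theorem gprimeTorus_eq_of_circleExp_eq (S' : Finset {w : InfinitePlace L // IsComplex w}) {c c' : {w : InfinitePlace L // IsComplex w} → Fin 3 → ℝ}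
    (h0 : ∀ w, w ∈ S' → c w 0 = c' w 0) (h : ∀ w i, (w ∉ S' ∨ i ≠ 0) → Circle.exp (c w i) = Circle.exp (c' w i)) :
    gprimeTorus L α S' c = gprimeTorus L α S' c' := by
  have hB : ∀ w, gprimeBlock L α w S' c = gprimeBlock L α w S' c' := by
    intro w
    have hall : ∀ i, Complex.exp ((c w i : ℂ) * I) = Complex.exp ((c' w i : ℂ) * I) := by
      intro i
      by_cases hi : i = 0
      · subst hi
        by_cases hw : w ∈ S'
        · rw [h0 w hw]
        · exact cexp_mul_I_eq_of_circleExp_eq (h w 0 (Or.inl hw))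
      · exact cexp_mul_I_eq_of_circleExp_eq (h w i (Or.inr hi))
    unfold gprimeBlock
    split_ifs with hw
    · rw [Subtype.mk.injEq]
      exact gprimeSplitGL_congr _ _ (h0 w hw.1) (hall 1) (hall 2)
    · rw [Subtype.mk.injEq]
      exact gprimeCptGL_congr _ hall
  unfold gprimeTorus
  congr 1
  funext w
  exact hB w

/-- **REDUCTION MOD `2π`**: every chart point is the chart point of a coordinate with all angle slots in `[0, 2π)` and the same chart slots (`toIcoMod` slot by slot; ★ `Circle.periodic_exp`).
[cite: Shelstad1979, §4 p. 22] [cite: Rogawski1990, §8.2 p. 122] -/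
theorem exists_reduced_gprimeTorus_eq (S' : Finset {w : InfinitePlace L // IsComplex w}) (c : {w : InfinitePlace L // IsComplex w} → Fin 3 → ℝ) :
    ∃ c' : {w : InfinitePlace L // IsComplex w} → Fin 3 → ℝ, (∀ w, w ∈ S' → c' w 0 = c w 0) ∧ (∀ w i, (w ∉ S' ∨ i ≠ 0) → c' w i ∈ Set.Ico 0 (2 * Real.pi)) ∧
      gprimeTorus L α S' c' = gprimeTorus L α S' c := by
  refine ⟨fun w i => if w ∈ S' ∧ i = 0 then c w i else toIcoMod Real.two_pi_pos 0 (c w i), fun w hw => by simp [hw], fun w i hwi => ?_, ?_⟩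
  · have hne : ¬ (w ∈ S' ∧ i = 0) := fun hh => hwi.elim (fun h1 => h1 hh.1) (fun h2 => h2 hh.2)
    simp only [hne, if_false]
    simpa using toIcoMod_mem_Ico Real.two_pi_pos 0 (c w i)
  · refine gprimeTorus_eq_of_circleExp_eq L α S' (fun w hw => by simp [hw]) fun w i hwi => ?_
    have hne : ¬ (w ∈ S' ∧ i = 0) := fun hh => hwi.elim (fun h1 => h1 hh.1) (fun h2 => h2 hh.2)
    simp only [hne, if_false]
    rw [toIcoMod, zsmul_eq_mul]
    exact Circle.periodic_exp.sub_int_mul_eq (toIcoDiv Real.two_pi_pos 0 (c w i))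

/-- **THE COMPACT TORUS PIECE**: the chart points with all coordinates in `[−M, M]` form a compact subset of `G′_∞` (continuous image of a closed box, ★ `continuous_gprimeTorus`).
[cite: Bouaziz1994IntegralesOrbitales, §2.3 p. 578] -/
theorem isCompact_gprimeTorus_image_box (S' : Finset {w : InfinitePlace L // IsComplex w}) (M : ℝ) :
    IsCompact (gprimeTorus L α S' '' {c : {w : InfinitePlace L // IsComplex w} → Fin 3 → ℝ | ∀ w i, c w i ∈ Set.Icc (-M) M}) := by
  have hbox : {c : {w : InfinitePlace L // IsComplex w} → Fin 3 → ℝ | ∀ w i, c w i ∈ Set.Icc (-M) M} = Set.Icc (fun _ _ => -M) (fun _ _ => M) := by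
    ext c
    simp only [Set.mem_setOf_eq, Set.mem_Icc, Pi.le_def]
    exact ⟨fun h => ⟨fun w i => (h w i).1, fun w i => (h w i).2⟩, fun h w i => ⟨h.1 w i, h.2 w i⟩⟩
  rw [hbox]
  exact isCompact_Icc.image (continuous_gprimeTorus L α S')

/-- Every chart point with chart slots bounded by `R` lies in the compact torus piece of size `max R (2π)` (after reducing the angles). [cite: Shelstad1979, §4 p. 22] -/
theorem gprimeTorus_mem_image_box (S' : Finset {w : InfinitePlace L // IsComplex w}) {R : ℝ} {c : {w : InfinitePlace L // IsComplex w} → Fin 3 → ℝ}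
    (hc : ∀ w, w ∈ S' → |c w 0| ≤ R) :
    gprimeTorus L α S' c ∈ gprimeTorus L α S' '' {c : {w : InfinitePlace L // IsComplex w} → Fin 3 → ℝ | ∀ w i, c w i ∈ Set.Icc (-(max R (2 * Real.pi))) (max R (2 * Real.pi))} := by
  obtain ⟨c', h0, hI, heq⟩ := exists_reduced_gprimeTorus_eq L α S' c
  refine ⟨c', fun w i => ?_, heq⟩
  by_cases hwi : w ∈ S' ∧ i = 0
  · obtain ⟨hw, rfl⟩ := hwi
    rw [h0 w hw]
    have h := hc w hw
    rw [abs_le] at h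
    exact ⟨by linarith [h.1, le_max_left R (2 * Real.pi)], h.2.trans (le_max_left _ _)⟩
  · have hwi' : w ∉ S' ∨ i ≠ 0 := by
      by_cases hw : w ∈ S'
      · exact Or.inr fun hi => hwi ⟨hw, hi⟩
      · exact Or.inl hw
    have h := hI w i hwi'
    exact ⟨by linarith [h.1, le_max_right R (2 * Real.pi), Real.two_pi_pos], h.2.le.trans (le_max_right _ _)⟩

end Box

/-! ## §5 The head: a test function whose stable orbital family does not vanish at the regular chart points with bounded chart slots -/

section Head

variable (L : Type) [Field L] [NumberField L] [IsCMField L] (α : Fin 3 → L)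
  [MeasurableSpace ↥(arch (↥(maximalRealSubfield L)) L (IsCMField.complexConj L) 3 (Matrix.diagonal α))] [BorelSpace ↥(arch (↥(maximalRealSubfield L)) L (IsCMField.complexConj L) 3 (Matrix.diagonal α))]
  (ν' : Measure ↥(arch (↥(maximalRealSubfield L)) L (IsCMField.complexConj L) 3 (Matrix.diagonal α))) [ν'.IsHaarMeasure] [ν'.IsMulRightInvariant]

/-- **(Σ4b-G) A REAL NON-NEGATIVE TEST FUNCTION WHOSE STABLE ORBITAL FAMILY DOES NOT VANISH AT THE REGULAR CHART POINTS WITH `|x_w| ≤ R`** (house frame `α_i ≠ 0`, admissible chart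
`S′ ⊆ splitChartPlaces L α`): a finite sum of bumps positive on the compact torus piece (§2, §4); at a regular `c` the stable sum is `R′(c) ≠ 0` times a sum with positive real part (§3).
[cite: Bouaziz1994IntegralesOrbitales, §5.1 p. 588] [cite: Varadarajan1989, §6 p. 229] [cite: Rogawski1990, §8.2 p. 122] [cite: Shelstad1979, Lemma 4.2 p. 23] -/
theorem exists_real_archSmooth_stableSumG_orbFamGExt_ne_zero (hα : ∀ i, α i ≠ 0) (S' : Finset {w : InfinitePlace L // IsComplex w})
    (hS' : ∀ w, w ∈ S' → w ∈ splitChartPlaces L α) (R : ℝ) :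
    ∃ f : ↥(arch (↥(maximalRealSubfield L)) L (IsCMField.complexConj L) 3 (Matrix.diagonal α)) → ℝ,
      Continuous f ∧ (∀ k, 0 ≤ f k) ∧ ArchSmooth L 3 (Matrix.diagonal α) (fun k => ((f k : ℝ) : ℂ)) ∧
      ∀ c : {w : InfinitePlace L // IsComplex w} → Fin 3 → ℝ, c ∈ RegG S' → (∀ w, w ∈ S' → |c w 0| ≤ R) →
        stableSumG (orbFamGExt L α ν' (fun k => ((f k : ℝ) : ℂ))) S' c ≠ 0 := by
  obtain ⟨f, hfc, hf0, hfpos, hfa⟩ := exists_real_archSmooth_pos_on L α (isCompact_gprimeTorus_image_box L α S' (max R (2 * Real.pi)))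
  have hfs : HasCompactSupport f := by
    have h := hfa.hasCompactSupport.comp_left Complex.zero_re
    refine (congrArg HasCompactSupport ?_).mp h
    funext k
    exact Complex.ofReal_re _
  refine ⟨f, hfc, hf0, hfa, fun c hc hR => ?_⟩
  exact stableSumG_orbFamGExt_ofReal_ne_zero L α ν' hα hS' hfc hfs hf0 hc (hfpos _ (gprimeTorus_mem_image_box L α S' hR))

/-- **(Σ4b-G), `ℂ`-VALUED HEAD**: for every house frame `α` (`α_i ≠ 0`), admissible chart type `S′` and bound `R` there is `a ∈ C_c^∞(G′_∞)` with `stableSumG (orbFamGExt L α ν′ a) S′ c ≠ 0`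
at every `c ∈ RegG S′` with `|c w 0| ≤ R` at the chart places.  (`G`-side of the road: `α := β₀`, `hS′` := ★ `mem_splitChartPlaces_quasiSplitWeights`.)
[cite: Bouaziz1994IntegralesOrbitales, §5.1 p. 588] [cite: Varadarajan1989, §6 p. 229] [cite: Shelstad1979, Lemma 4.2 p. 23] -/
theorem exists_archSmooth_stableSumG_orbFamGExt_ne_zero (hα : ∀ i, α i ≠ 0) (S' : Finset {w : InfinitePlace L // IsComplex w})
    (hS' : ∀ w, w ∈ S' → w ∈ splitChartPlaces L α) (R : ℝ) :
    ∃ a : ↥(arch (↥(maximalRealSubfield L)) L (IsCMField.complexConj L) 3 (Matrix.diagonal α)) → ℂ,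
      ArchSmooth L 3 (Matrix.diagonal α) a ∧ ∀ c : {w : InfinitePlace L // IsComplex w} → Fin 3 → ℝ, c ∈ RegG S' → (∀ w, w ∈ S' → |c w 0| ≤ R) →
        stableSumG (orbFamGExt L α ν' a) S' c ≠ 0 := by
  obtain ⟨f, -, -, hfa, hne⟩ := exists_real_archSmooth_stableSumG_orbFamGExt_ne_zero L α ν' hα S' hS' R
  exact ⟨fun k => ((f k : ℝ) : ℂ), hfa, hne⟩

end Head

end Literature.NumberTheory.Rogawski1990

end
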